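import Mathlib
import Summits.Ventures.HodgeRepro.Tier4.Common.AdelicDefs
import Summits.Ventures.HodgeRepro.Tier4.Line1.PlaneDefs
import Summits.Ventures.HodgeRepro.Tier4.Line1.RationalRotation
import Summits.Ventures.HodgeRepro.Tier4.Line1.C7Components
import Summits.Ventures.HodgeRepro.Tier4.Line1.C7LocalWitt
import Summits.Ventures.HodgeRepro.Tier4.Line1.WittQuasiReflection

/-!
# Tier4/Line1/LocalWittGeneral — Witt's theorem for the hermitian plane over any field of characteristic `0`; C7.1 and C7.1∞ closed

Blind re-derivation cell `pub-hodge-repro`, Tier 4 «PROVE THE STEP» (README §9–§10), LINE L1, seat t4-L1-p3 (prover);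
LOCAL WITT = the binder `hwitt` of t4-L1-p2's `exists_compact_local_stab_mul_fin_of_witt` /
`exists_compact_local_stab_mul_inf_of_witt` (C7LocalWitt p673752), discharged (my claim S13080).

* `exists_isometry_vecMul_eq_of_norm_eq` (**Witt**, any field `F` of characteristic `0`, split or not, isotropic or
  not): for `β(x,x) = β(y,y) ≠ 0` there is `h` with `h Ω = Ω h`, `h B hᵀ = B`, `x h = y`. Proof: rotate `y` inside its
  `A`-orbit, `y′ := y · η(t)` with `η(t) = ((1 − d t²)/(1 + d t²), 2t/(1 + d t²))` of norm one, where `t ∈ {0, …, 6}` is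
  chosen (`exists_good_param`: the bad `t` are the roots of a non-zero polynomial of degree `≤ 6`, Mathlib's
  `eq_zero_of_natDegree_lt_card_of_eval_eq_zero`) so that `c = β(x − y′, x − y′) ≠ 0` and `h(x − y′, x)` is invertible;
  the quasi-reflection of `WittQuasiReflection` sends `x` to `y′` and `h := σ · η̄` sends `x` to `y`. In the non-split
  case the rotation is unnecessary (`η ∈ {±1}` suffices); it is what makes the SPLIT places (`A = F × F`, where
  `h(x − y, x)` can be a non-zero zero divisor) go through.
* `exists_localU_vecMul_eq`: the same through any embedding `φ : k → F` for a genuine definite plane (`d ≠ 0` from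
  `IsGenuineRow`, `β(φ v₀, φ v₀) ≠ 0` from `IsDefinite`).
* `localWitt_fin` / `localWitt_inf`: t4-L1-p2's `hwitt` VERBATIM at every finite / infinite place, and the closures
  `exists_compact_local_stab_mul_fin_genuine` / `exists_compact_local_stab_mul_inf_genuine` (C7.1 / C7.1∞ of t4-L1-p4's census,
  C7-rungs-sig.lean L115–L131, with NO hypothesis beyond `IsGenuineRow W ∧ IsDefinite W`).
Mathlib + the line's landed modules only; no printed input.

Nothing here says anything about the status of the Hodge conjecture for CM abelian varieties, which is NOT proved
(HC_CM is NOT proved by anyone in this repository).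
-/

set_option autoImplicit false

noncomputable section

namespace Summit.Ventures.HodgeRepro.Tier4.Line1.Witt

open Matrix

variable {F : Type*} [Field F] {B Ω : Matrix (Fin 4) (Fin 4) F} {d : F}

/-! ## 5. Genericity: a rotation of `y` inside its `A`-orbit puts the pair in non-degenerate position -/

open Polynomial in
/-- The quadratic polynomial `a X² + b X + c`. -/
def quad (a b c : F) : Polynomial F := C a * X ^ 2 + C b * X + C c

open Polynomial in
/-- Evaluation of `quad`. -/
theorem eval_quad (a b c t : F) : (quad a b c).eval t = a * t ^ 2 + b * t + c := by
  simp [quad]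

open Polynomial in
/-- `quad a b c ≠ 0` unless all coefficients vanish. -/
theorem quad_ne_zero {a b c : F} (h : ¬(a = 0 ∧ b = 0 ∧ c = 0)) : quad a b c ≠ 0 := by
  intro h0
  apply h
  have h2 := congrArg (fun p : Polynomial F => p.coeff 2) h0
  have h1 := congrArg (fun p : Polynomial F => p.coeff 1) h0
  have hc := congrArg (fun p : Polynomial F => p.coeff 0) h0
  simp [quad, Polynomial.coeff_X, Polynomial.coeff_C, Polynomial.coeff_X_pow] at h2 h1 hc
  exact ⟨h2, h1, hc⟩

open Polynomial in
/-- `quad` has degree `≤ 2`. -/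
theorem natDegree_quad_le (a b c : F) : (quad a b c).natDegree ≤ 2 := Polynomial.natDegree_quadratic_le

/-- A non-zero polynomial of degree `≤ 6` does not vanish at all of `0, 1, …, 6` (characteristic zero). -/
theorem exists_eval_ne_zero [CharZero F] {Q : Polynomial F} (hQ : Q ≠ 0) (hdeg : Q.natDegree ≤ 6) :
    ∃ n : Fin 7, Q.eval ((n : ℕ) : F) ≠ 0 := by
  by_contra h
  simp only [not_exists, not_not] at h
  refine hQ (Polynomial.eq_zero_of_natDegree_lt_card_of_eval_eq_zero Q (f := fun n : Fin 7 => ((n : ℕ) : F))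
    (fun a b hab => Fin.ext (Nat.cast_injective hab)) h ?_)
  rw [Fintype.card_fin]
  omega

/-- **The good rotation parameter**: for `a′ ≠ 0`, `d ≠ 0` there is `t` with `1 + d t² ≠ 0`,
`d (a′ + H₀) t² − 2 H₁ t + (a′ − H₀) ≠ 0` and `d (d (a′+H₀)² + H₁²) t² − 4 d a′ H₁ t + (d (a′−H₀)² + H₁²) ≠ 0`. -/
theorem exists_good_param [CharZero F] {a' : F} (ha : a' ≠ 0) (hd : d ≠ 0) (H₀ H₁ : F) :
    ∃ t : F, 1 + d * t ^ 2 ≠ 0 ∧ d * (a' + H₀) * t ^ 2 - 2 * H₁ * t + (a' - H₀) ≠ 0 ∧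
      d * (d * (a' + H₀) ^ 2 + H₁ ^ 2) * t ^ 2 - 4 * d * a' * H₁ * t + (d * (a' - H₀) ^ 2 + H₁ ^ 2) ≠ 0 := by
  have h1 : quad d 0 1 ≠ 0 := quad_ne_zero (fun h => one_ne_zero h.2.2)
  have h2 : quad (d * (a' + H₀)) (-(2 * H₁)) (a' - H₀) ≠ 0 := by
    refine quad_ne_zero fun ⟨e1, e2, e3⟩ => ha ?_
    have : a' + H₀ = 0 := (mul_eq_zero.mp e1).resolve_left hd
    linear_combination (this + e3) / 2
  have h3 : quad (d * (d * (a' + H₀) ^ 2 + H₁ ^ 2)) (-(4 * d * a' * H₁)) (d * (a' - H₀) ^ 2 + H₁ ^ 2) ≠ 0 := by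
    refine quad_ne_zero fun ⟨e1, e2, e3⟩ => ha ?_
    have hH₁ : H₁ = 0 := by
      have : 4 * d * a' * H₁ = 0 := by linear_combination -e2
      have h4 : (4 : F) * d * a' ≠ 0 := mul_ne_zero (mul_ne_zero (by norm_num) hd) ha
      exact (mul_eq_zero.mp this).resolve_left h4
    rw [hH₁] at e1 e3
    have e1' : d * (a' + H₀) ^ 2 = 0 := by
      have : d * (d * (a' + H₀) ^ 2) = 0 := by linear_combination e1
      exact (mul_eq_zero.mp this).resolve_left hd
    have e3' : d * (a' - H₀) ^ 2 = 0 := by linear_combination e3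
    have f1 : (a' + H₀) ^ 2 = 0 := (mul_eq_zero.mp e1').resolve_left hd
    have f3 : (a' - H₀) ^ 2 = 0 := (mul_eq_zero.mp e3').resolve_left hd
    have g1 : a' + H₀ = 0 := pow_eq_zero_iff (n := 2) (by norm_num) |>.mp f1
    have g3 : a' - H₀ = 0 := pow_eq_zero_iff (n := 2) (by norm_num) |>.mp f3
    linear_combination (g1 + g3) / 2
  have hQ : quad d 0 1 * quad (d * (a' + H₀)) (-(2 * H₁)) (a' - H₀) *
      quad (d * (d * (a' + H₀) ^ 2 + H₁ ^ 2)) (-(4 * d * a' * H₁)) (d * (a' - H₀) ^ 2 + H₁ ^ 2) ≠ 0 :=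
    mul_ne_zero (mul_ne_zero h1 h2) h3
  have hdeg : (quad d 0 1 * quad (d * (a' + H₀)) (-(2 * H₁)) (a' - H₀) *
      quad (d * (d * (a' + H₀) ^ 2 + H₁ ^ 2)) (-(4 * d * a' * H₁)) (d * (a' - H₀) ^ 2 + H₁ ^ 2)).natDegree ≤ 6 := by
    refine Polynomial.natDegree_mul_le.trans ?_
    have := Polynomial.natDegree_mul_le (p := quad d 0 1) (q := quad (d * (a' + H₀)) (-(2 * H₁)) (a' - H₀))
    have a1 := natDegree_quad_le d 0 (1 : F)
    have a2 := natDegree_quad_le (d * (a' + H₀)) (-(2 * H₁)) (a' - H₀)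
    have a3 := natDegree_quad_le (d * (d * (a' + H₀) ^ 2 + H₁ ^ 2)) (-(4 * d * a' * H₁)) (d * (a' - H₀) ^ 2 + H₁ ^ 2)
    omega
  obtain ⟨n, hn⟩ := exists_eval_ne_zero hQ hdeg
  refine ⟨((n : ℕ) : F), ?_, ?_, ?_⟩
  · intro h0; apply hn
    rw [Polynomial.eval_mul, Polynomial.eval_mul, eval_quad]
    rw [show d * ((n : ℕ) : F) ^ 2 + 0 * ((n : ℕ) : F) + 1 = 0 from by linear_combination h0, zero_mul, zero_mul]
  · intro h0; apply hn
    rw [Polynomial.eval_mul, Polynomial.eval_mul, eval_quad (d * (a' + H₀))]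
    rw [show d * (a' + H₀) * ((n : ℕ) : F) ^ 2 + -(2 * H₁) * ((n : ℕ) : F) + (a' - H₀) = 0 from by
      linear_combination h0, mul_zero, zero_mul]
  · intro h0; apply hn
    rw [Polynomial.eval_mul, eval_quad (d * (d * (a' + H₀) ^ 2 + H₁ ^ 2))]
    rw [show d * (d * (a' + H₀) ^ 2 + H₁ ^ 2) * ((n : ℕ) : F) ^ 2 + -(4 * d * a' * H₁) * ((n : ℕ) : F) +
      (d * (a' - H₀) ^ 2 + H₁ ^ 2) = 0 from by linear_combination h0, mul_zero]

/-! ## 6. Witt's theorem for the hermitian plane over any field of characteristic zero -/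

/-- **WITT FOR THE HERMITIAN PLANE, row convention, any field of characteristic `0`** (split or not, isotropic or
not): for `β(x,x) = β(y,y) ≠ 0` there is `h` commuting with `Ω`, preserving `B` (`h B hᵀ = B`), with `x h = y`.
Proof: rotate `y` in its `A`-orbit to `y′ = y η(t)`, `η(t) = ((1 − d t²)/(1 + d t²), 2t/(1 + d t²))` of norm one, with
`t` from `exists_good_param` so that `c = β(x − y′, x − y′) ≠ 0` and `h(x − y′, x)` is invertible; the quasi-reflection
`σ` of `exists_qrefl_vecMul_eq` sends `x` to `y′`, and `h := σ · η̄` sends `x` to `y`. -/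
theorem exists_isometry_vecMul_eq_of_norm_eq [CharZero F] (hd : d ≠ 0) (hB : Bᵀ = B)
    (hrow : Ω * B = -(B * Ωᵀ)) (hΩ : Ω * Ω = -(d • (1 : Matrix (Fin 4) (Fin 4) F))) {x y : Fin 4 → F}
    (hx : x ᵥ* B ⬝ᵥ x ≠ 0) (hxy : x ᵥ* B ⬝ᵥ x = y ᵥ* B ⬝ᵥ y) :
    ∃ h : Matrix (Fin 4) (Fin 4) F, h * Ω = Ω * h ∧ h * B * hᵀ = B ∧ x ᵥ* h = y := by
  obtain ⟨a', ha'⟩ : ∃ a', x ᵥ* B ⬝ᵥ x = a' := ⟨_, rfl⟩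
  obtain ⟨H₀, hH₀⟩ : ∃ H₀, x ᵥ* B ⬝ᵥ y = H₀ := ⟨_, rfl⟩
  obtain ⟨H₁, hH₁⟩ : ∃ H₁, x ᵥ* B ⬝ᵥ (y ᵥ* Ω) = H₁ := ⟨_, rfl⟩
  rw [ha'] at hx hxy
  obtain ⟨t, ht0, ht1, ht2⟩ := exists_good_param hx hd H₀ H₁
  obtain ⟨η₀, hη₀⟩ : ∃ η₀, (1 - d * t ^ 2) / (1 + d * t ^ 2) = η₀ := ⟨_, rfl⟩
  obtain ⟨η₁, hη₁⟩ : ∃ η₁, 2 * t / (1 + d * t ^ 2) = η₁ := ⟨_, rfl⟩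
  have hη : η₀ * η₀ + d * (η₁ * η₁) = 1 := by
    rw [← hη₀, ← hη₁]
    field_simp
    ring
  have hη' : η₀ * η₀ + d * (-η₁ * -η₁) = 1 := by rw [neg_mul_neg]; exact hη
  obtain ⟨y', hy'⟩ : ∃ y', y ᵥ* scal Ω η₀ η₁ = y' := ⟨_, rfl⟩
  have hy'y' : y' ᵥ* B ⬝ᵥ y' = a' := by rw [← hy', pairR_scal hB hrow hΩ, hη, one_mul, ← hxy]
  have hxy' : x ᵥ* B ⬝ᵥ x = y' ᵥ* B ⬝ᵥ y' := by rw [ha', hy'y']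
  have hxxΩ : x ᵥ* B ⬝ᵥ (x ᵥ* Ω) = 0 := by rw [pairR_comm hB]; exact pairR_Ω_self hB hrow x
  have hyΩΩ : x ᵥ* B ⬝ᵥ ((y ᵥ* Ω) ᵥ* Ω) = -(d * H₀) := by
    rw [vecMul_Ω_Ω hΩ, dotProduct_neg, dotProduct_smul, smul_eq_mul, hH₀]
  -- the atoms in the rotated position
  have hL : x ᵥ* B ⬝ᵥ y' = η₀ * H₀ + η₁ * H₁ := by
    rw [← hy', vecMul_scal, dotProduct_add, dotProduct_smul, dotProduct_smul, smul_eq_mul, smul_eq_mul, hH₀, hH₁]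
  have hα : x ᵥ* B ⬝ᵥ ((x - y') ᵥ* Ω) = -(η₀ * H₁ - d * η₁ * H₀) := by
    rw [Matrix.sub_vecMul, dotProduct_sub, hxxΩ, ← hy', vecMul_scal, Matrix.add_vecMul, Matrix.smul_vecMul,
      Matrix.smul_vecMul, dotProduct_add, dotProduct_smul, dotProduct_smul, smul_eq_mul, smul_eq_mul, hH₁, hyΩΩ]
    ring
  have hc_eq : (x - y') ᵥ* B ⬝ᵥ (x - y') = 2 * a' - 2 * (η₀ * H₀ + η₁ * H₁) := by
    rw [Matrix.sub_vecMul, sub_dotProduct, dotProduct_sub, dotProduct_sub, pairR_comm hB y' x, hL, ha', hy'y']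
    ring
  have hq1 : d * (a' + H₀) * t ^ 2 - 2 * H₁ * t + (a' - H₀) = (1 + d * t ^ 2) * (a' - (η₀ * H₀ + η₁ * H₁)) := by
    rw [← hη₀, ← hη₁]
    field_simp
    ring
  have hq2 : d * (d * (a' + H₀) ^ 2 + H₁ ^ 2) * t ^ 2 - 4 * d * a' * H₁ * t + (d * (a' - H₀) ^ 2 + H₁ ^ 2) =
      (1 + d * t ^ 2) * (d * a' ^ 2 - 2 * d * a' * (η₀ * H₀ + η₁ * H₁) + d * H₀ ^ 2 + H₁ ^ 2) := by
    rw [← hη₀, ← hη₁]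
    field_simp
    ring
  have hc : (x - y') ᵥ* B ⬝ᵥ (x - y') ≠ 0 := by
    rw [hc_eq]
    intro h0
    apply ht1
    rw [hq1, show a' - (η₀ * H₀ + η₁ * H₁) = 0 from by linear_combination h0 / 2, mul_zero]
  have hN : d * ((x - y') ᵥ* B ⬝ᵥ (x - y')) * ((x - y') ᵥ* B ⬝ᵥ (x - y')) +
      4 * ((x ᵥ* B ⬝ᵥ ((x - y') ᵥ* Ω)) * (x ᵥ* B ⬝ᵥ ((x - y') ᵥ* Ω))) ≠ 0 := by
    rw [hc_eq, hα]
    intro h0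
    apply ht2
    rw [hq2]
    have key : d * a' ^ 2 - 2 * d * a' * (η₀ * H₀ + η₁ * H₁) + d * H₀ ^ 2 + H₁ ^ 2 = 0 := by
      linear_combination h0 / 4 - (d * H₀ ^ 2 + H₁ ^ 2) * hη
    rw [key, mul_zero]
  obtain ⟨ε₀, ε₁, hε, hxσ⟩ := exists_qrefl_vecMul_eq hB hΩ hd hxy' hc hN
  refine ⟨qrefl B Ω d (x - y') ε₀ ε₁ * scal Ω η₀ (-η₁), ?_, ?_, ?_⟩
  · rw [Matrix.mul_assoc, scal_mul_Ω, ← Matrix.mul_assoc, qrefl_mul_Ω hrow hΩ hd, Matrix.mul_assoc]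
  · refine isometry_of_pairR fun z z' => ?_
    rw [← Matrix.vecMul_vecMul, ← Matrix.vecMul_vecMul, pairR_scal hB hrow hΩ, hη', one_mul,
      pairR_qrefl hB hrow hΩ hd hc hε]
  · rw [← Matrix.vecMul_vecMul, hxσ, ← hy', vecMul_scal_scal_conj hΩ, hη, one_smul]

end Summit.Ventures.HodgeRepro.Tier4.Line1.Witt

namespace Summit.Ventures.HodgeRepro.Tier4.Line1

open NumberField IsDedekindDomain HeightOneSpectrum Summit.Ventures.HodgeRepro.Tier4.Common Matrix Witt

variable {k : Type} [Field k] [NumberField k] (W : PlaneData k)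

/-- **Local Witt through any field embedding `φ : k → F`**: for a genuine definite plane and `v₀ ≠ 0` rational, every
`x ∈ F⁴` of the same `B`-norm as `φ(v₀)` is `φ(v₀) h` for some `h ∈ U(W)(F)` (`h Ω = Ω h`, `h B hᵀ = B`, read through
`φ`). -/
theorem exists_localU_vecMul_eq (hg : IsGenuineRow W) (hW : IsDefinite W) {F : Type*} [Field F] (φ : k →+* F)
    {v₀ : Fin 4 → k} (hv₀ : v₀ ≠ 0) (x : Fin 4 → F)
    (hx : x ᵥ* W.B.map φ ⬝ᵥ x = (fun i => φ (v₀ i)) ᵥ* W.B.map φ ⬝ᵥ (fun i => φ (v₀ i))) :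
    ∃ h : Matrix (Fin 4) (Fin 4) F, h * W.Ω.map φ = W.Ω.map φ * h ∧ h * W.B.map φ * hᵀ = W.B.map φ ∧
      (fun i => φ (v₀ i)) ᵥ* h = x := by
  haveI : CharZero F := charZero_of_injective_ringHom φ.injective
  obtain ⟨d, hΩ, hd⟩ := hg.1
  have hrow := hg.2.1
  have hd0 : d ≠ 0 := by
    rintro rfl
    exact hd ⟨0, by simp⟩
  have hB' : (W.B.map φ)ᵀ = W.B.map φ := by rw [← Matrix.transpose_map, W.B_symm]
  have hrow' : W.Ω.map φ * W.B.map φ = -(W.B.map φ * (W.Ω.map φ)ᵀ) := by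
    rw [← Matrix.map_mul, hrow, ← Matrix.transpose_map, ← Matrix.map_mul, Matrix.map_neg _ (map_neg φ)]
  have hΩ' : W.Ω.map φ * W.Ω.map φ = -(φ d • (1 : Matrix (Fin 4) (Fin 4) F)) := by
    rw [← Matrix.map_mul, hΩ, Matrix.map_neg _ (map_neg φ), Matrix.map_smul' φ _ _ (map_mul φ),
      Matrix.map_one φ (map_zero φ) (map_one φ)]
  have hd' : φ d ≠ 0 := (map_ne_zero φ).mpr hd0
  have hv₀' : (fun i => φ (v₀ i)) ᵥ* W.B.map φ ⬝ᵥ (fun i => φ (v₀ i)) ≠ 0 := by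
    have e : (fun i => φ (v₀ i)) ᵥ* W.B.map φ ⬝ᵥ (fun i => φ (v₀ i)) = φ (v₀ ᵥ* W.B ⬝ᵥ v₀) := by
      rw [RingHom.map_dotProduct]
      congr 1
      funext i
      exact (RingHom.map_vecMul φ W.B v₀ i).symm
    rw [e, ← Matrix.dotProduct_mulVec]
    exact (map_ne_zero φ).mpr (pair_self_ne_zero_of_isDefinite W hW hv₀)
  exact exists_isometry_vecMul_eq_of_norm_eq hd' hB' hrow' hΩ' hv₀' hx.symm

/-- **LOCAL WITT AT A FINITE PLACE** — t4-L1-p2's binder `hwitt` of `exists_compact_local_stab_mul_fin_of_witt`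
(C7LocalWitt p673752) VERBATIM: `U(W)(k_v)` is transitive on the sphere of `v₀`. -/
theorem localWitt_fin (hg : IsGenuineRow W) (hW : IsDefinite W) (v : HeightOneSpectrum (𝓞 k)) (v₀ : Fin 4 → k)
    (hv₀ : v₀ ≠ 0) :
    ∀ x : Fin 4 → v.adicCompletion k,
      x ᵥ* W.B.map (algebraMap k (v.adicCompletion k)) ⬝ᵥ x =
        finRat v v₀ ᵥ* W.B.map (algebraMap k (v.adicCompletion k)) ⬝ᵥ finRat v v₀ →
      (x ᵥ* W.Ω.map (algebraMap k (v.adicCompletion k))) ᵥ* W.B.map (algebraMap k (v.adicCompletion k)) ⬝ᵥ x =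
        (finRat v v₀ ᵥ* W.Ω.map (algebraMap k (v.adicCompletion k))) ᵥ*
          W.B.map (algebraMap k (v.adicCompletion k)) ⬝ᵥ finRat v v₀ →
      ∃ h ∈ localU W v, finRat v v₀ ᵥ* h = x := fun x hx _ =>
  let ⟨h, h1, h2, h3⟩ := exists_localU_vecMul_eq W hg hW (algebraMap k (v.adicCompletion k)) hv₀ x hx
  ⟨h, ⟨h1, h2⟩, h3⟩

/-- **LOCAL WITT AT AN INFINITE PLACE** — t4-L1-p2's binder `hwitt` of `exists_compact_local_stab_mul_inf_of_witt`
VERBATIM: `U(W)(k_w)` is transitive on the sphere of `v₀`. -/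
theorem localWitt_inf (hg : IsGenuineRow W) (hW : IsDefinite W) (w : InfinitePlace k) (v₀ : Fin 4 → k)
    (hv₀ : v₀ ≠ 0) :
    ∀ x : Fin 4 → w.Completion,
      x ᵥ* W.B.map (algebraMap k w.Completion) ⬝ᵥ x =
        infRat w v₀ ᵥ* W.B.map (algebraMap k w.Completion) ⬝ᵥ infRat w v₀ →
      (x ᵥ* W.Ω.map (algebraMap k w.Completion)) ᵥ* W.B.map (algebraMap k w.Completion) ⬝ᵥ x =
        (infRat w v₀ ᵥ* W.Ω.map (algebraMap k w.Completion)) ᵥ*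
          W.B.map (algebraMap k w.Completion) ⬝ᵥ infRat w v₀ →
      ∃ h ∈ localUInf W w, infRat w v₀ ᵥ* h = x := fun x hx _ =>
  let ⟨h, h1, h2, h3⟩ := exists_localU_vecMul_eq W hg hW (algebraMap k w.Completion) hv₀ x hx
  ⟨h, ⟨h1, h2⟩, h3⟩

/-- **C7.1 CLOSED** (t4-L1-p4's C7-rungs-sig.lean L115–L121 VERBATIM): the local fibration over the stabiliser at a
finite place, with no hypothesis beyond `IsGenuineRow W ∧ IsDefinite W` — t4-L1-p2's
`exists_compact_local_stab_mul_fin_of_witt` with `hwitt := localWitt_fin`. -/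
theorem exists_compact_local_stab_mul_fin_genuine (hg : IsGenuineRow W) (hW : IsDefinite W)
    (v : HeightOneSpectrum (𝓞 k)) (v₀ : Fin 4 → k) (hv₀ : v₀ ≠ 0)
    {C : Set (Fin 4 → v.adicCompletion k)} (hC : IsCompact C) :
    ∃ K : Set (Matrix (Fin 4) (Fin 4) (v.adicCompletion k)), IsCompact K ∧
      ∀ h ∈ localU W v, finRat v v₀ ᵥ* h ∈ C →
        ∃ s ∈ localU W v, finRat v v₀ ᵥ* s = finRat v v₀ ∧ ∃ κ ∈ localU W v, κ ∈ K ∧ h = s * κ :=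
  exists_compact_local_stab_mul_fin_of_witt W hW v v₀ (localWitt_fin W hg hW v v₀ hv₀) hC

/-- **C7.1∞ CLOSED** (C7-rungs-sig.lean L124–L131 VERBATIM): the local fibration at an infinite place, with no
hypothesis beyond `IsGenuineRow W ∧ IsDefinite W`. -/
theorem exists_compact_local_stab_mul_inf_genuine (hg : IsGenuineRow W) (hW : IsDefinite W)
    (w : InfinitePlace k) (v₀ : Fin 4 → k) (hv₀ : v₀ ≠ 0)
    {C : Set (Fin 4 → w.Completion)} (hC : IsCompact C) :
    ∃ K : Set (Matrix (Fin 4) (Fin 4) w.Completion), IsCompact K ∧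
      ∀ h ∈ localUInf W w, infRat w v₀ ᵥ* h ∈ C →
        ∃ s ∈ localUInf W w, infRat w v₀ ᵥ* s = infRat w v₀ ∧
          ∃ κ ∈ localUInf W w, κ ∈ K ∧ h = s * κ :=
  exists_compact_local_stab_mul_inf_of_witt W hW w v₀ (localWitt_inf W hg hW w v₀ hv₀) hC

end Summit.Ventures.HodgeRepro.Tier4.Line1

end
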